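import Mathlib
import HarnessLib

/-!
# Markman 2025 — §7.4.1 «Construction of a projective bundle»: the injectivity (7.4.1) by the snake lemma, and the
# rank ∕ `Σ(Q)` bookkeeping of LEMMA 7.4.1, Step 1 — AS PRINTED (with Mukai 1978, Thm 7.11 ∕ Cor 7.12 BY VALUE),
# kernel-checked

E. Markman: [M] *Cycles on abelian 2n-folds of Weil type from secant sheaves on abelian n-folds*,
arXiv:2502.03415 **v2** (2025-06-08), bib `Markman2025SecantWeil` — UNREFEREED PREPRINT. «p. N L m» = PyMuPDF line `m`
of page `N` of the public v2 PDF (sha256/16 `8155aa33870069b8`), read at seat lit-w-markman g20 (pub-hsemireg LIT-W,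
2026-08-24; §7.4.1 p. 45 L10 – p. 47 L35 from the text layer, p. 45 and p. 46 L3–35 re-read BY EYE on the renders
`r_mar25v2_p45_full.png`, `r_mar25v2_p46_top.png` in `HOME/lit/Markman-renders-litw-markman-g20/`; sheet
`LOCATOR-SHEET-MARKMAN.md` §58 (the six steps of §7.4.2 that USE Lemma 7.4.1) and §64–65 (this file)). S. Mukai: [Mu4] *Semi-homogeneous vector bundles on an abelian variety*,
J. Math. Kyoto Univ. 18 (1978), bib `Mukai1978` — REFEREED; THEOREM 7.11 and COROLLARY 7.12 (pp. 271–272) were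
read BY EYE ×2 across seats (lit-1 g24 ∣ lit-w-mukai g6, sheet `LOCATOR-SHEET-MUKAI.md` §1.7) and enter BY VALUE.
Row M-Mk4 of the LIT-W table (the PROVED CASE of Conjecture 7.3.9, §7.4.2) rests on Lemma 7.4.1: «Given a class
`δ₀ ∈ H²(X, ℚ/ℤ)`, there exists an open neighborhood `U` of `0` in `S` and a holomorphic projective bundle
`p : 𝒫 → π⁻¹(U)`, such that `δ(𝒫|_X) = δ₀`.» (p. 45 L50–53).

## What is printed (verbatim)

* [M] p. 45 L10–43: «7.4.1. Construction of a projective bundle. Let `X` be an abelian variety. The composition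
  (7.4.1) `H²(X, μ_r) ≅ H²(X, (1/r)ℤ/ℤ) → H²(X, ℚ/ℤ)` is injective, where the left arrow is the isomorphism induced by
  the inverse of the sheaf isomorphism `exp(2πi(•)) : (1/r)ℤ/ℤ → μ_r` and the right arrow is induced by the inclusion
  `(1/r)ℤ ⊂ ℚ`. The injectivity of the right arrow follows from the snake lemma applied to
  [rows `0 → H²(X, ℤ) → H²(X, (1/r)ℤ) → H²(X, (1/r)ℤ/ℤ) → 0` and `0 → H²(X, ℤ) → H²(X, ℚ) → H²(X, ℚ/ℤ) → 0`, vertical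
  arrows `=`, `H²(X, (1/r)ℤ) → H²(X, ℚ)`, `H²(X, (1/r)ℤ/ℤ) → H²(X, ℚ/ℤ)`], where the right exactness of the horizontal
  rows follows from the Universal Coefficient Theorem and the torsion freeness of `H^*(X, ℤ)`, which implies also the
  injectivity of the middle vertical arrow.»
* [M] LEMMA 7.4.1, proof, Step 1 (p. 45 L54 – p. 46 L5): «Assume first that `δ₀` is the image of a class `(1/r)δ̃₀`
  via the natural homomorphism `H²(X, ℚ) → H²(X, ℚ/ℤ)`, where `δ̃₀ ∈ H²(X, ℤ)` is a primitive class of Hodge type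
  (1, 1). Then there exists a simple semi-homogeneous vector bundle `Q` over `X` with `δ(ℙ(Q)) = δ₀`, by [Mu4,
  Theorem 7.11(1)]. The rank `r(Q)` of `Q` is divisible by `r` and divides `rⁿ`, where `n` is the dimension of `X`.
  Let `Σ(Q) ⊂ X̂` be the subgroup `{L : Q ⊗ L ≅ Q}`. Choose an origin for `X` and denote by `X_r` the subgroup of `X`
  of `r`-torsion points. We have the short exact sequence `0 → X_r ∩ K(δ̃₀) → X_r → Σ(Q) → 0`, where `K(δ̃₀)` is the
  kernel of the homomorphism `φ_D : X → X̂` associated to a line-bundle `D` with `c₁(D) = δ̃₀`, by [Mu4, Theorem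
  7.11(4)]. Furthermore, `End(Q) ≅ ⊕_{L∈Σ(Q)} L`, by [Mu4, Proposition 7.1].»
* [M] p. 46 L28–54: «Given `L₁, L₂ ∈ Σ(Q)`, let the sheaf homomorphism `e_{L₂,L₁} : L₂ ⊗ L₁⁻¹ → End(A, A)` send a
  section `s` of `L₂ ⊗ L₁⁻¹` to the homomorphism mapping the direct summand `L₁` of `A` to the direct summand `L₂` by
  tensorization by `s` and annihilating all other direct summands of `A`. … Consider the composition
  `L₃ ⊗ L₁⁻¹ ≅ (L₃ ⊗ L₂⁻¹) ⊗ (L₂ ⊗ L₁⁻¹) —e_{L₃,L₂} ⊗ e_{L₂,L₁}→ End(A) ⊗ End(A) → End(A)`, where the right arrow is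
  multiplication in `End(A)`. The above composition is equal to `e_{L₃,L₁}` and is independent of `a`.»
* [Mu4] THEOREM 7.11 (p. 271): «Let `δ = [L]/l` … (4) There are exact sequences of group schemes
  `0 → X_l ∩ K(L) → X_l →^{φ_L} Σ(E) → 0` and `0 → X_l ∩ K(L) → K(L) →^{l_X} K(E) → 0`. (5) `ord(X_l ∩ K(L)) = u²` for
  some positive integer `u`. For this `u`, we have `r(E) = l^g/u` and `χ(E) = χ(L)/u`.»; COROLLARY 7.12 (pp. 271–272):
  «Assume that `l` is minimal among the positive integers `l′` such that `δ = [L′]/l′` for some line bundle `L′`.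
  Then (1) `l` divides `r(E)` and `r(E)` divides `l^g`. Especially, `l ≤ r(E) ≤ l^g`. …»

## The model and what is proved (0 `def`, 0 named fact, 0 sorry; nothing geometric)
§A — (7.4.1) «The injectivity of the right arrow follows from the snake lemma»: for additive homomorphisms
`M —ι→ P —π→ C`, `M —ι′→ P′ —π′→ C′` (the two rows with the SAME `M = H²(X, ℤ)` on the left), vertical maps `f : P → P′`,
`g : C → C′` with commuting squares, `π ∘ ι = 0`, `π` onto, `ker π′ ⊆ im ι′` and `f` injective («the injectivity of the
middle vertical arrow») ⟹ `g` injective (`injective_of_snake`; the rows' exactness and `f`'s injectivity — UCT and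
torsion freeness — are BY VALUE).
§B — «The rank `r(Q)` of `Q` is divisible by `r` and divides `rⁿ`»: this is [Mu4] Cor. 7.12 (1) for `l = r`, whose
hypothesis — `r` is the MINIMAL denominator of `δ₀ = (1/r)δ̃₀` — is tacit in print and follows from «`δ̃₀` is a
primitive class»: in a torsion-free `ℤ`-module, if `x` is primitive (every `m` with `m·z = x` is a unit) and
`l′·x = r·y`, then `r ∣ l′` (`dvd_of_primitive`, Bézout); Cor. 7.12's «Especially, `l ≤ r(E) ≤ l^g`» from the two
divisibilities (`bounds_of_dvd`).
§C — the orders behind «`0 → X_r ∩ K(δ̃₀) → X_r → Σ(Q) → 0`» and «`End(Q) ≅ ⊕_{L∈Σ(Q)} L`»: with `ord(X_r) = r^{2n}`,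
`ord(X_r ∩ K(δ̃₀)) = u²` and `r(Q)·u = rⁿ` ([Mu4] Thm 7.11 (4)(5), BY VALUE) the exact sequence gives
`ord Σ(Q) = r(Q)²` — consistent with `rank End(Q) = r(Q)²` (`card_sigma_eq_rank_sq`; a seat consistency check of two
printed statements, ×0).
§D — «The above composition is equal to `e_{L₃,L₁}` and is independent of `a`»: in a local frame of the line bundles
`L ∈ Σ(Q)` the `e_{L₂,L₁}` are the matrix units of `End(A)`, `A = ⊕_{L∈Σ(Q)} L`, and `E_{L₃L₂}E_{L₂L₁} = E_{L₃L₁}`,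
`E_{L₃L₂}E_{L₂′L₁} = 0` for `L₂ ≠ L₂′` (`matrixUnit_comp`, `matrixUnit_comp_of_ne`; Mathlib's `Matrix.single`).
BY VALUE (not modelled): UCT, `exp(2πi•)`, [Mu4] Thm 7.11 (1)(4)(5), Prop. 7.1 and Cor. 7.12 themselves, the Azumaya
structure equations among the `a_{L₁,L₂}` (print leaves them implicit — NOT written out here either), Step 2, and the
deformation argument p. 47 L3–17. Nothing here says that Conjecture 7.3.9 holds beyond the printed cases, that any
object of the pub-hsemireg cell is semiregular, or that HC / HC_CM / HC_AV is proved.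
-/

namespace Literature.AlgebraicGeometry.Markman2025.Lemma741

/-! ### §A — (7.4.1): injectivity of `H²(X, (1/r)ℤ/ℤ) → H²(X, ℚ/ℤ)` by the snake lemma -/

section Snake

variable {M P C P' C' : Type*} [AddCommGroup M] [AddCommGroup P] [AddCommGroup C] [AddCommGroup P']
  [AddCommGroup C']

/-- «The injectivity of the right arrow follows from the snake lemma applied to [the two rows] … the torsion freeness
of `H^*(X, ℤ)`, which implies also the injectivity of the middle vertical arrow.» — rows `M —ι→ P —π→ C → 0` (a complex,
`π` onto) and `M —ι′→ P′ —π′→ C′` (exact at `P′`), the left vertical arrow the identity of `M` (`f ∘ ι = ι′`), the right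
square commuting (`g ∘ π = π′ ∘ f`) and the middle arrow `f` injective: then the right arrow `g` is injective (the
snake lemma's `ker g ↪ coker(id_M) = 0`, chased by hand).
[cite: Markman2025SecantWeil, §7.4.1 (7.4.1), p. 45 L10–43] -/
theorem injective_of_snake (ι : M →+ P) (π : P →+ C) (ι' : M →+ P') (π' : P' →+ C') (f : P →+ P') (g : C →+ C')
    (hcomplex : ∀ m, π (ι m) = 0) (hπ : Function.Surjective π) (hexact' : ∀ p', π' p' = 0 → ∃ m, ι' m = p')
    (hsq₁ : ∀ m, f (ι m) = ι' m) (hsq₂ : ∀ p, g (π p) = π' (f p)) (hf : Function.Injective f) :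
    Function.Injective g := by
  refine (injective_iff_map_eq_zero g).mpr fun c hc => ?_
  obtain ⟨p, rfl⟩ := hπ c
  have hp' : π' (f p) = 0 := by rw [← hsq₂, hc]
  obtain ⟨m, hm⟩ := hexact' (f p) hp'
  have hpm : p = ι m := hf (by rw [hsq₁, hm])
  rw [hpm, hcomplex]

end Snake

/-! ### §B — «The rank `r(Q)` of `Q` is divisible by `r` and divides `rⁿ`» -/

section Rank

variable {N : Type*} [AddCommGroup N] [NoZeroSMulDivisors ℤ N]

/-- The tacit step: «`δ̃₀ ∈ H²(X, ℤ)` is a primitive class» forces `r` to be the MINIMAL denominator of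
`δ₀ = (1/r)δ̃₀` — if also `δ₀ = [L′]/l′`, i.e. `l′·δ̃₀ = r·[L′]` in the torsion-free group `H²(X, ℤ)`, then `r ∣ l′`
(so [Mu4] Cor. 7.12 applies with `l = r`). Primitive = every `m ∈ ℤ` with `m·z = x` for some `z` is a unit. Proof:
Bézout for `gcd(l′, r)`. [cite: Markman2025SecantWeil, proof of Lemma 7.4.1 Step 1, p. 45 L54–60] -/
theorem dvd_of_primitive {x y : N} (hprim : ∀ (m : ℤ) (z : N), m • z = x → IsUnit m) {r l : ℤ} (hr : r ≠ 0)
    (h : l • x = r • y) : r ∣ l := by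
  set g : ℤ := (Int.gcd l r : ℤ) with hg
  have hg0 : g ≠ 0 := by
    rw [hg, Nat.cast_ne_zero, Ne, Int.gcd_eq_zero_iff]
    exact fun hh => hr hh.2
  obtain ⟨l₁, hl₁⟩ : g ∣ l := Int.gcd_dvd_left l r
  obtain ⟨r₁, hr₁⟩ : g ∣ r := Int.gcd_dvd_right l r
  -- Bézout, reduced by `g`
  have hbez : l₁ * Int.gcdA l r + r₁ * Int.gcdB l r = 1 := by
    have hb := Int.gcd_eq_gcd_ab l r
    rw [← hg] at hb
    apply mul_left_cancel₀ hg0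
    rw [mul_one, mul_add, ← mul_assoc, ← mul_assoc, ← hl₁, ← hr₁]
    exact hb.symm
  -- the reduced relation `l₁·x = r₁·y`
  have hred : l₁ • x = r₁ • y := by
    apply smul_right_injective N hg0
    simp only [← mul_smul, ← hl₁, ← hr₁]
    exact h
  -- `x = r₁·(a·y + b·x)`, so `r₁` is a unit by primitivity
  have hx : r₁ • (Int.gcdA l r • y + Int.gcdB l r • x) = x := by
    conv_rhs => rw [← one_smul ℤ x, ← hbez]
    rw [add_smul, mul_comm l₁, mul_smul, hred]
    module
  have hu : IsUnit r₁ := hprim r₁ _ hx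
  -- `r = g·r₁ ∣ g ∣ l`
  calc r = g * r₁ := hr₁
    _ ∣ g * 1 := mul_dvd_mul_left g hu.dvd
    _ ∣ l := by rw [mul_one]; exact ⟨l₁, hl₁⟩

/-- [Mu4] COR. 7.12 (1) «`l` divides `r(E)` and `r(E)` divides `l^g`. Especially, `l ≤ r(E) ≤ l^g`» — the «Especially»
from the two divisibilities (rank positive, `l ≥ 1`); with `l = r` this is the sentence «The rank `r(Q)` of `Q` is
divisible by `r` and divides `rⁿ`» and its numerical shadow `r ≤ r(Q) ≤ rⁿ`.
[cite: Mukai1978, Cor. 7.12 (1), pp. 271–272] -/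
theorem bounds_of_dvd {l rk g : ℕ} (hl : 1 ≤ l) (hrk : 0 < rk) (h₁ : l ∣ rk) (h₂ : rk ∣ l ^ g) :
    l ≤ rk ∧ rk ≤ l ^ g :=
  ⟨Nat.le_of_dvd hrk h₁, Nat.le_of_dvd (pow_pos hl g) h₂⟩

end Rank

/-! ### §C — the orders in `0 → X_r ∩ K(δ̃₀) → X_r → Σ(Q) → 0` versus `End(Q) ≅ ⊕_{L∈Σ(Q)} L` -/

/-- With `ord(X_r) = r^{2n}` (the `r`-torsion of an abelian `n`-fold), the exact sequence
«`0 → X_r ∩ K(δ̃₀) → X_r → Σ(Q) → 0`» (`ord X_r = ord(X_r ∩ K(δ̃₀)) · ord Σ(Q)`) and [Mu4] Thm 7.11 (5)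
(`ord(X_r ∩ K(δ̃₀)) = u²`, `r(Q)·u = rⁿ`) — all BY VALUE as hypotheses — the order of `Σ(Q)` is `r(Q)²`, matching the
rank `r(Q)²` of «`End(Q) ≅ ⊕_{L∈Σ(Q)} L`» (a consistency check of the two printed statements; seat remark ×0).
[cite: Markman2025SecantWeil, proof of Lemma 7.4.1 Step 1, p. 45 L60 – p. 46 L5] -/
theorem card_sigma_eq_rank_sq {r n u rk s tors : ℕ} (hu : 0 < u) (htors : tors = r ^ (2 * n))
    (hexact : tors = u ^ 2 * s) (hrk : rk * u = r ^ n) : s = rk ^ 2 := by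
  have h : u ^ 2 * s = u ^ 2 * rk ^ 2 := by
    rw [← hexact, htors, pow_mul', ← hrk]; ring
  exact Nat.eq_of_mul_eq_mul_left (pow_pos hu 2) h

/-! ### §D — «The above composition is equal to `e_{L₃,L₁}` and is independent of `a`» -/

section MatrixUnits

variable {ι : Type*} [Fintype ι] [DecidableEq ι] {R : Type*} [Semiring R]

/-- «… `e_{L₂,L₁}` … the homomorphism mapping the direct summand `L₁` of `A` to the direct summand `L₂` … and
annihilating all other direct summands of `A`. … The above composition is equal to `e_{L₃,L₁}` and is independent of
`a`.» — in a local frame of the lines `L ∈ Σ(Q)` (index type `ι`), `e_{L₂,L₁}` is the matrix unit `E_{L₂L₁}` of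
`End(A) ≅ Mat_ι`, and `E_{L₃L₂}·E_{L₂L₁} = E_{L₃L₁}` whatever the multiplication `a` on `A` is.
[cite: Markman2025SecantWeil, proof of Lemma 7.4.1 Step 1, p. 46 L28–54] -/
theorem matrixUnit_comp (L₁ L₂ L₃ : ι) :
    Matrix.single L₃ L₂ (1 : R) * Matrix.single L₂ L₁ 1 = Matrix.single L₃ L₁ 1 := by
  rw [Matrix.single_mul_single_same, mul_one]

/-- … and `E_{L₃L₂}·E_{L₂′L₁} = 0` when `L₂ ≠ L₂′` («annihilating all other direct summands»).
[cite: Markman2025SecantWeil, proof of Lemma 7.4.1 Step 1, p. 46 L28–35] -/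
theorem matrixUnit_comp_of_ne {L₁ L₂ L₂' L₃ : ι} (h : L₂ ≠ L₂') :
    Matrix.single L₃ L₂ (1 : R) * Matrix.single L₂' L₁ 1 = 0 :=
  Matrix.single_mul_single_of_ne 1 L₃ L₂ L₂' h 1

end MatrixUnits

end Literature.AlgebraicGeometry.Markman2025.Lemma741
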